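import Summits.BirchSwinnertonDyer.BirchSwinnertonDyer.Theorems.PrintCf2RamifiedOffTYZGenusPeriodTraceNorm
import Summits.BirchSwinnertonDyer.BirchSwinnertonDyer.Theorems.PrintCf2RamifiedOffTYZGenusPeriodExactDescent
import HarnessLib

/-!
# THE EXACT-DESCENT IDENTITIES FOR THE GENUS PERIOD, PROVED: `κ⁰_{ℍ′}(Z(d)) = [N_{H/L} x(z_d)]` and `κ⁺_{ℍ′}(Z(d)) = [N_{H(i)/M}(x(z_d) − 2i)]` in
# `ℍ′^×/ℍ′^{×2}` from the seven-block display alone — and C⁺ on the visible R2 rows as ONE square-class question granted only THEOREM A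
# (crux stmt-BirchSwinnertonDyer-20509 `RamifiedOffTYZOfFacts`, line `offtyz-v7`, LEAD g29, cycle 30, part 2c)

HONEST FRAMING (cell `bsd-print-cf2`, route `PrintCf2`; `--supports stmt-BirchSwinnertonDyer-20509`; theorems only, `def`-free, no `sorry`, standard axioms).
BSD is not proved by any of this; no class is closed by this file; item 23431 (C⁺) and crux 20509 stay OPEN.

g26 (`…GenusPeriodNormClass`, p790023) read `κ(Z(d))` as the class of the Φ-norm IN THE BIG FIELD `M` and left the descent to `ℍ′_n` open; part 1 of this
cycle (`…GenusPeriodExactDescent`, p799839) took the descended identities as hypothesis shapes `hED0`, `hEDp`.  THIS FILE DISCHARGES THEM: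

* §6 ★★★ `twoDescentComponent_genusPeriod_eq_sqClass_norm` / `…_zero` — for the data (S1)–(S3) of the seven-block display at `d` and `Z(d)` not
  `2`-torsion: `∃ N₀ ∈ ℍ′_n`, `ι N₀ = ∏_{t∈Φ}(t x₀ − 2ι(i))`, `N₀ ≠ 0`, **`κ⁺_{ℍ′}(Z(d)) = [N₀]`**; `∃ N₁`, `ι N₁ = ∏_{t∈Φ} t x₀`, `N₁ ≠ 0`,
  **`κ⁰_{ℍ′}(Z(d)) = [N₁]`**.  Proof: halve the `z^t` in `Ω = M̄` (part 2b §5), apply the trace–norm theorem (part 2b §4) to the automorphisms of `Ω`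
  fixing `ι(ℍ′_n)` — they restrict to automorphisms of `M` trivial on `ι(L_d(i))` and so permute the `z^t` by (S3) (`AlgEquiv.restrictNormal`) — and
  descend by infinite Galois theory (`InfiniteGalois.fixedField_fixingSubgroup`, `Ω/ℚ` Galois).
* §7 ★★★ `exists_norms_exactDescent` (both identities from `SevenBlockCMSpec d`) and ★★★★ `levelTwo_iff_secondNorm_of_visible_R2_of_facts` — BY NAME
  from conjuncts 1, 2, 4, 5 of 𝔅_ram + `tyz_sevenBlockCMData`: on an R2 row `n = lq` (`ord L(E_n) = 1`, visible generator `X(h) ∉ 2ℚ^{×2}`), in the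
  display package, for `Z(n)` not `2`-torsion there are the norms `N₁ = N_{H/L}(x(z_n))`, `N₀ = N_{H(i)/M}(x(z_n) − 2i) ∈ ℍ′_n` with:
  **`[N₁] = 1` ∧ `ζ₈ ∉ ℍ′_n` ⟹ ( `2 ∥ L` for all `L` with `𝓛(n)² = L²`  ⟺  neither `N₀` nor `N₀·i` is a square in `ℍ′_n` )** — the only unproved
  CM-side input left is `[N₁] = 1`, THEOREM A of the memo (a transfer in `Cl_{𝔭̄³}(ℚ(√−lq))`; proof on paper, 25/25 numerically).

References: [cite: SilvermanAEC2009, Thm. X.1.1, Prop. X.1.4]; [cite: NeukirchSchmidtWingberg2008, §1.5]; [cite: TianYuanZhang2017, §1, §3.1 (p0010 L38,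
L85–L92, L111; p0011 L1–L8, L53–L66), §3.2 (p0012 L8–L9), Lemma 3.16, Lemma 3.18, Thm. 3.5, Thm. 1.2]; [cite: BurungaleFlach2024, Thm 1.1 / Cor. 3];
[cite: Darmon2004, Thm. 3.22]; tree: p790023 (`…GenusPeriodNormClass`), p799839 (`…GenusPeriodExactDescent`), parts 2a/2b of this cycle.
-/

noncomputable section

open scoped Classical

open WeierstrassCurve WeierstrassCurve.Affine WeierstrassCurve.Affine.Point
  Literature.NumberTheory.EllipticCurves Literature.NumberTheory.EllipticCurves.Rank1Residual
  Summit.BirchSwinnertonDyer.Rank1Residual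
  Literature.NumberTheory.EllipticCurves.TianYuanZhang2017
  Literature.NumberTheory.EllipticCurves.TianYuanZhang2017.W2
  Summit.BirchSwinnertonDyer.PrintCf2.VisibleGenerator

set_option autoImplicit false

namespace Summit.BirchSwinnertonDyer.PrintCf2.GenusPeriodTraceNorm

/-! ## §6 Descent to `ℍ′_n`: the exact-descent identity for the genus period of a seven-block, from the display (S1)–(S3) -/

section Descent

variable {n : ℕ} {M : Type} [Field M] [NumberField M] [IsGalois ℚ M]

open Literature.NumberTheory.EllipticCurves.TianYuanZhang2017.GenusPointData (galPtOver TrivialOnLOver)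

/-- Transport of an affine point along an algebra map. [folklore] -/
theorem exists_map_some {F K : Type} [Field F] [Field K] [CharZero F] [CharZero K] (f : F →ₐ[ℚ] K) {x y : F}
    (h : (curveA.baseChange F).toAffine.Nonsingular x y) :
    ∃ h' : (curveA.baseChange K).toAffine.Nonsingular (f x) (f y), Point.map (W' := curveA) f (Point.some x y h) = Point.some (f x) (f y) h' :=
  ⟨_, by rw [Point.map_some]⟩

/-- ★★★ **THE EXACT-DESCENT IDENTITY FOR THE GENUS PERIOD OF A SEVEN-BLOCK, IN `ℍ′_n` ITSELF** (coordinate at `T⁺ = (2i, 0)`).  For the data of the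
seven-block display (S1)–(S3) at `d` — `ι(Z(d)) = Σ_{t∈Φ} z^t` with `z = (x₀, y₀)`, no `z^t` a cusp, automorphisms of `M` trivial on `ι(L_d(i))` permute the
`z^t` — and `Z(d)` not `2`-torsion: there is `N₀ ∈ ℍ′_n` with `ι(N₀) = ∏_{t∈Φ} (t x₀ − 2ι(i))` (the norm `N_{H_d(i)/L_d(i)}(x(z_d) − 2i)`) and
**`κ⁺_{ℍ′}(Z(d)) = [N₀]` in `ℍ′^×/ℍ′^{×2}`** — g26's identity (p790023, read in `M`) DESCENDED; the hypothesis `hEDp` of `…GenusPeriodExactDescent`.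
Proof: halve the `z^t` in `Ω = M̄` (§5), apply `traceNorm_sq_fixed` (§4) to the automorphisms of `Ω` fixing `ι(ℍ′_n)`, and conclude by infinite Galois
theory (`Ω^{Aut(Ω/ιℍ′)} = ιℍ′`). [cite: SilvermanAEC2009, Thm. X.1.1, Prop. X.1.4] [cite: NeukirchSchmidtWingberg2008, §1.5] [cite: TianYuanZhang2017, §3.1 (p0011 L53–L66)] -/
theorem twoDescentComponent_genusPeriod_eq_sqClass_norm (D : GenusPointData n) {d : ℕ} (ι : D.H →ₐ[ℚ] M)
    {x₀ y₀ : M} (h₀ : (curveA.baseChange M).toAffine.Nonsingular x₀ y₀) (Φ : Finset (M ≃ₐ[ℚ] M))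
    (hS1 : Point.map (W' := curveA) ι (D.Z d) = ∑ t ∈ Φ, galPtOver M t (.some x₀ y₀ h₀))
    (hS2 : ∀ t ∈ Φ, ¬ ((2 : ℕ) • galPtOver M t (.some x₀ y₀ h₀) = 0 ∨ (2 : ℕ) • galPtOver M t (.some x₀ y₀ h₀) = tauOne))
    (hS3 : ∀ g : M ≃ₐ[ℚ] M, D.TrivialOnLOver ι d g →
      ∃ π : Φ → Φ, Function.Bijective π ∧
        ∀ t : Φ, galPtOver M g (galPtOver M (t : M ≃ₐ[ℚ] M) (.some x₀ y₀ h₀)) = galPtOver M (π t : M ≃ₐ[ℚ] M) (.some x₀ y₀ h₀))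
    (hZ2 : (2 : ℕ) • D.Z d ≠ 0) :
    ∃ N₀ : D.H, ι N₀ = ∏ t ∈ Φ, ((t : M ≃ₐ[ℚ] M) x₀ - 2 * ι D.im) ∧ N₀ ≠ 0 ∧
      twoDescentComponent (curveA.baseChange D.H).toAffine (2 * D.im) 0 (-(2 * D.im)) (D.Z d) = sqClass N₀ := by
  -- the norm N₀ ∈ ℍ′_n (g26)
  obtain ⟨N₀, hN₀, -⟩ := GenusPeriodNorm.exists_norm_in_H_twoDescentComponent_genusPeriod_eq D ι h₀ Φ hS1 hS2 hS3
  suffices hmain : N₀ ≠ 0 ∧ twoDescentComponent (curveA.baseChange D.H).toAffine (2 * D.im) 0 (-(2 * D.im)) (D.Z d) = sqClass N₀ from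
    ⟨N₀, hN₀, hmain⟩
  -- Z(d) = (X, Y) affine, X ≠ 2i
  obtain ⟨X, Y, hXY, hY, hZ⟩ := exists_eq_some_of_two_smul_ne_zero hZ2
  have hX2 : X ≠ 2 * D.im := (A_X_ne_of_Y_ne D.im_sq hXY hY).2.1
  -- the factors of N₀ are non-zero
  have himM : (ι D.im) ^ 2 = -1 := by rw [← map_pow, D.im_sq, map_neg, map_one]
  have hfac : ∀ t ∈ Φ, (t : M ≃ₐ[ℚ] M) x₀ - 2 * ι D.im ≠ 0 := by
    intro t ht
    have h2 : (2 : ℕ) • galPtOver M t (.some x₀ y₀ h₀) ≠ 0 := fun h0 => hS2 t ht (Or.inl h0)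
    rw [GenusPeriodNorm.galPtOver_some t h₀] at h2
    exact sub_ne_zero.mpr (GenusPeriodNorm.X_ne_of_two_smul_ne_zero himM _ h2).1
  have hN0 : N₀ ≠ 0 := by
    intro h0; rw [h0, _root_.map_zero] at hN₀
    exact (Finset.prod_ne_zero_iff.mpr hfac) hN₀.symm
  -- pass to Ω = algebraic closure of M
  let Ω : Type := AlgebraicClosure M
  let jM : M →ₐ[ℚ] Ω := IsScalarTower.toAlgHom ℚ M Ω
  let j : D.H →ₐ[ℚ] Ω := jM.comp ι
  have himΩ : (j D.im) ^ 2 = -1 := by rw [← map_pow, D.im_sq, map_neg, map_one]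
  -- the family P_t, t ∈ Φ, in A(Ω)
  let zM : APoint M := Point.some x₀ y₀ h₀
  have hPM : ∀ t : Φ, (curveA.baseChange M).toAffine.Nonsingular ((t : M ≃ₐ[ℚ] M) x₀) ((t : M ≃ₐ[ℚ] M) y₀) := fun t =>
    nonsingular_apply_of_fixed (W := (curveA.baseChange M).toAffine) ((t : M ≃ₐ[ℚ] M) : M →+* M)
      (GenusPeriodNorm.coeff_fixed_over _).1 (GenusPeriodNorm.coeff_fixed_over _).2.1 (GenusPeriodNorm.coeff_fixed_over _).2.2.1
      (GenusPeriodNorm.coeff_fixed_over _).2.2.2.1 (GenusPeriodNorm.coeff_fixed_over _).2.2.2.2 h₀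
  have hP : ∀ t : Φ, (curveA.baseChange Ω).toAffine.Nonsingular (jM ((t : M ≃ₐ[ℚ] M) x₀)) (jM ((t : M ≃ₐ[ℚ] M) y₀)) := fun t =>
    (exists_map_some jM (hPM t)).1
  have hPt : ∀ t : Φ, Point.map (W' := curveA) jM (galPtOver M (t : M ≃ₐ[ℚ] M) zM) =
      Point.some (jM ((t : M ≃ₐ[ℚ] M) x₀)) (jM ((t : M ≃ₐ[ℚ] M) y₀)) (hP t) := by
    intro t
    rw [GenusPeriodNorm.galPtOver_some (t : M ≃ₐ[ℚ] M) h₀, Point.map_some]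
  -- halves in Ω
  have hhalf : ∀ t : Φ, ∃ (u w : Ω) (hq : (curveA.baseChange Ω).toAffine.Nonsingular u w), w ≠ 0 ∧
      (2 : ℕ) • (Point.some u w hq : APoint Ω) = Point.some (jM ((t : M ≃ₐ[ℚ] M) x₀)) (jM ((t : M ≃ₐ[ℚ] M) y₀)) (hP t) := by
    intro t
    obtain ⟨Q, hQ⟩ := exists_two_smul_eq himΩ (Point.some (jM ((t : M ≃ₐ[ℚ] M) x₀)) (jM ((t : M ≃ₐ[ℚ] M) y₀)) (hP t))
    have hQ2 : (2 : ℕ) • Q ≠ 0 := by rw [hQ]; exact Point.some_ne_zero _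
    obtain ⟨u, w, hq, hw, rfl⟩ := exists_eq_some_of_two_smul_ne_zero hQ2
    exact ⟨u, w, hq, hw, hQ⟩
  choose xQ yQ hQ hyQ hhalf using hhalf
  -- the sum: Σ_t P_t = j(Z(d)) = (jX, jY)
  have hsumM : ∑ t : Φ, Point.map (W' := curveA) jM (galPtOver M (t : M ≃ₐ[ℚ] M) zM) = Point.map (W' := curveA) j (D.Z d) := by
    change _ = Point.map (W' := curveA) (jM.comp ι) (D.Z d)
    rw [← Point.map_map, hS1, map_sum]
    exact Finset.sum_coe_sort Φ (fun t => Point.map (W' := curveA) jM (galPtOver M t zM))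
  obtain ⟨hS, hSe⟩ := exists_map_some j hXY
  have hsum : ∑ t : Φ, (Point.some (jM ((t : M ≃ₐ[ℚ] M) x₀)) (jM ((t : M ≃ₐ[ℚ] M) y₀)) (hP t) : APoint Ω) =
      Point.some (j X) (j Y) hS := by
    rw [← hSe, ← hZ, ← hsumM]
    exact Finset.sum_congr rfl fun t _ => (hPt t).symm
  -- the trace–norm theorem over Ω
  obtain ⟨ρ, hρ, hfix⟩ := traceNorm_sq_fixed himΩ (fun t : Φ => jM ((t : M ≃ₐ[ℚ] M) x₀)) (fun t => jM ((t : M ≃ₐ[ℚ] M) y₀)) hP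
    xQ yQ hQ hyQ hhalf hS hsum
  -- ρ is fixed by every automorphism of Ω fixing j(ℍ′_n)
  have hfixed : ∀ σ : Ω ≃ₐ[ℚ] Ω, σ ∈ IntermediateField.fixingSubgroup j.fieldRange → σ ρ = ρ := by
    intro σ hσ
    rw [IntermediateField.mem_fixingSubgroup_iff] at hσ
    have hσj : ∀ a : D.H, σ (j a) = j a := fun a => hσ _ (AlgHom.mem_fieldRange.mpr ⟨a, rfl⟩)
    refine hfix σ (hσj D.im) ?_
    -- the restriction of σ to M is trivial on ι(L_d(i)), so it permutes the z^t (S3)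
    let g : M ≃ₐ[ℚ] M := σ.restrictNormal M
    have hg : ∀ m : M, jM (g m) = σ (jM m) := fun m => AlgEquiv.restrictNormal_commutes σ M m
    have hgι : ∀ a : D.H, g (ι a) = ι a := fun a =>
      (algebraMap M Ω).injective (by
        change jM (g (ι a)) = jM (ι a)
        rw [hg]; exact hσj a)
    have hgL : D.TrivialOnLOver ι d g := ⟨hgι _, fun d' _ _ => hgι _⟩
    obtain ⟨π, hπ, hperm⟩ := hS3 g hgL
    refine ⟨Equiv.ofBijective π hπ, fun t => ?_⟩
    -- galPtOver Ω σ (P_t) = j(g · z^t) = P_{π t}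
    have hcomp : (σ : Ω →ₐ[ℚ] Ω).comp jM = jM.comp (g : M →ₐ[ℚ] M) := AlgHom.ext fun m => (hg m).symm
    have e1 : galPtOver Ω σ (Point.map (W' := curveA) jM (galPtOver M (t : M ≃ₐ[ℚ] M) zM)) =
        Point.map (W' := curveA) jM (galPtOver M g (galPtOver M (t : M ≃ₐ[ℚ] M) zM)) := by
      rw [galPtOver, galPtOver, Point.map_map, Point.map_map]
      exact congrArg (fun f => Point.map (W' := curveA) f (galPtOver M (t : M ≃ₐ[ℚ] M) zM)) hcomp
    rw [← hPt t, e1, hperm t, hPt]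
    rfl
  -- hence ρ ∈ j(ℍ′_n)
  haveI : Algebra.IsAlgebraic ℚ Ω := Algebra.IsAlgebraic.trans ℚ M Ω
  haveI : IsAlgClosure ℚ Ω := { isAlgClosed := inferInstance, isAlgebraic := inferInstance }
  haveI : Algebra.IsSeparable ℚ Ω := Algebra.IsAlgebraic.isSeparable_of_perfectField
  haveI : Normal ℚ Ω := IsAlgClosure.normal ℚ Ω
  haveI : IsGalois ℚ Ω := IsGalois.mk
  have hρmem : ρ ∈ IntermediateField.fixedField (IntermediateField.fixingSubgroup j.fieldRange) := by
    rw [IntermediateField.mem_fixedField_iff]; exact fun σ hσ => hfixed σ hσ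
  rw [InfiniteGalois.fixedField_fixingSubgroup] at hρmem
  obtain ⟨r, hr⟩ := AlgHom.mem_fieldRange.mp hρmem
  -- pull the identity back to ℍ′_n
  have hprod : ∏ t : Φ, (jM ((t : M ≃ₐ[ℚ] M) x₀) - 2 * j D.im) = j N₀ := by
    change _ = jM (ι N₀)
    rw [hN₀, map_prod, ← Finset.prod_coe_sort Φ]
    refine Finset.prod_congr rfl fun t _ => ?_
    rw [map_sub, map_mul, map_ofNat]; rfl
  have hdesc : (X - 2 * D.im) * N₀ = r ^ 2 := by
    have hinj : Function.Injective j := j.toRingHom.injective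
    apply hinj
    rw [map_mul, map_sub, map_mul, map_ofNat, map_pow, hr, ← hρ, hprod]
  exact ⟨hN0, GenusPeriodExactDescent.twoDescentComponent_eq_sqClass_of_exactDescent_two_im D hXY hZ hX2 hN0 hdesc⟩

/-- ★★★ **THE EXACT-DESCENT IDENTITY FOR THE GENUS PERIOD OF A SEVEN-BLOCK, IN `ℍ′_n` ITSELF** (coordinate at `τ(1) = (0, 0)`).  For the data of the
seven-block display (S1)–(S3) at `d` — `ι(Z(d)) = Σ_{t∈Φ} z^t` with `z = (x₀, y₀)`, no `z^t` a cusp, automorphisms of `M` trivial on `ι(L_d(i))` permute the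
`z^t` — and `Z(d)` not `2`-torsion: there is `N₁ ∈ ℍ′_n` with `ι(N₁) = ∏_{t∈Φ} t x₀` (the norm `N_{H_d/L_d}(x(z_d))`) and **`κ⁰_{ℍ′}(Z(d)) = [N₁]` in `ℍ′^×/ℍ′^{×2}`** — the
hypothesis `hED0` of `…GenusPeriodExactDescent`.
Proof: halve the `z^t` in `Ω = M̄` (§5), apply `traceNorm_sq_fixed` (§4) to the automorphisms of `Ω` fixing `ι(ℍ′_n)`, and conclude by infinite Galois
theory (`Ω^{Aut(Ω/ιℍ′)} = ιℍ′`). [cite: SilvermanAEC2009, Thm. X.1.1, Prop. X.1.4] [cite: NeukirchSchmidtWingberg2008, §1.5] [cite: TianYuanZhang2017, §3.1 (p0011 L53–L66)] -/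
theorem twoDescentComponent_genusPeriod_eq_sqClass_norm_zero (D : GenusPointData n) {d : ℕ} (ι : D.H →ₐ[ℚ] M)
    {x₀ y₀ : M} (h₀ : (curveA.baseChange M).toAffine.Nonsingular x₀ y₀) (Φ : Finset (M ≃ₐ[ℚ] M))
    (hS1 : Point.map (W' := curveA) ι (D.Z d) = ∑ t ∈ Φ, galPtOver M t (.some x₀ y₀ h₀))
    (hS2 : ∀ t ∈ Φ, ¬ ((2 : ℕ) • galPtOver M t (.some x₀ y₀ h₀) = 0 ∨ (2 : ℕ) • galPtOver M t (.some x₀ y₀ h₀) = tauOne))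
    (hS3 : ∀ g : M ≃ₐ[ℚ] M, D.TrivialOnLOver ι d g →
      ∃ π : Φ → Φ, Function.Bijective π ∧
        ∀ t : Φ, galPtOver M g (galPtOver M (t : M ≃ₐ[ℚ] M) (.some x₀ y₀ h₀)) = galPtOver M (π t : M ≃ₐ[ℚ] M) (.some x₀ y₀ h₀))
    (hZ2 : (2 : ℕ) • D.Z d ≠ 0) :
    ∃ N₁ : D.H, ι N₁ = ∏ t ∈ Φ, (t : M ≃ₐ[ℚ] M) x₀ ∧ N₁ ≠ 0 ∧
      twoDescentComponent (curveA.baseChange D.H).toAffine 0 (2 * D.im) (-(2 * D.im)) (D.Z d) = sqClass N₁ := by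
  -- the norm N₁ ∈ ℍ′_n (Galois descent in M, as g26)
  have hfixM : ∀ g : M ≃ₐ[ℚ] M, g ∈ IntermediateField.fixingSubgroup ι.fieldRange →
      g (∏ t ∈ Φ, ((t : M ≃ₐ[ℚ] M) x₀ - 0)) = ∏ t ∈ Φ, ((t : M ≃ₐ[ℚ] M) x₀ - 0) := fun g hg =>
    GenusPeriodNorm.norm_fixed_of_trivialOnL D ι h₀ Φ hS3 g (GenusPeriodNorm.trivialOnLOver_of_mem_fixingSubgroup D ι d hg) 0
      (_root_.map_zero g)
  obtain ⟨N₀, hN₀⟩ := GenusPeriodNorm.exists_eq_of_forall_fixing D ι hfixM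
  simp only [sub_zero] at hN₀
  suffices hmain : N₀ ≠ 0 ∧ twoDescentComponent (curveA.baseChange D.H).toAffine 0 (2 * D.im) (-(2 * D.im)) (D.Z d) = sqClass N₀ from
    ⟨N₀, hN₀, hmain⟩
  -- Z(d) = (X, Y) affine, X ≠ 2i
  obtain ⟨X, Y, hXY, hY, hZ⟩ := exists_eq_some_of_two_smul_ne_zero hZ2
  have hX2 : X ≠ 0 := (A_X_ne_of_Y_ne D.im_sq hXY hY).1
  -- the factors of N₀ are non-zero
  have himM : (ι D.im) ^ 2 = -1 := by rw [← map_pow, D.im_sq, map_neg, map_one]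
  have hfac : ∀ t ∈ Φ, (t : M ≃ₐ[ℚ] M) x₀ ≠ 0 := by
    intro t ht
    have h2 : (2 : ℕ) • galPtOver M t (.some x₀ y₀ h₀) ≠ 0 := fun h0 => hS2 t ht (Or.inl h0)
    rw [GenusPeriodNorm.galPtOver_some t h₀] at h2
    exact (GenusPeriodNorm.X_ne_of_two_smul_ne_zero himM _ h2).2.1
  have hN0 : N₀ ≠ 0 := by
    intro h0; rw [h0, _root_.map_zero] at hN₀
    exact (Finset.prod_ne_zero_iff.mpr hfac) hN₀.symm
  -- pass to Ω = algebraic closure of M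
  let Ω : Type := AlgebraicClosure M
  let jM : M →ₐ[ℚ] Ω := IsScalarTower.toAlgHom ℚ M Ω
  let j : D.H →ₐ[ℚ] Ω := jM.comp ι
  have himΩ : (j D.im) ^ 2 = -1 := by rw [← map_pow, D.im_sq, map_neg, map_one]
  -- the family P_t, t ∈ Φ, in A(Ω)
  let zM : APoint M := Point.some x₀ y₀ h₀
  have hPM : ∀ t : Φ, (curveA.baseChange M).toAffine.Nonsingular ((t : M ≃ₐ[ℚ] M) x₀) ((t : M ≃ₐ[ℚ] M) y₀) := fun t =>
    nonsingular_apply_of_fixed (W := (curveA.baseChange M).toAffine) ((t : M ≃ₐ[ℚ] M) : M →+* M)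
      (GenusPeriodNorm.coeff_fixed_over _).1 (GenusPeriodNorm.coeff_fixed_over _).2.1 (GenusPeriodNorm.coeff_fixed_over _).2.2.1
      (GenusPeriodNorm.coeff_fixed_over _).2.2.2.1 (GenusPeriodNorm.coeff_fixed_over _).2.2.2.2 h₀
  have hP : ∀ t : Φ, (curveA.baseChange Ω).toAffine.Nonsingular (jM ((t : M ≃ₐ[ℚ] M) x₀)) (jM ((t : M ≃ₐ[ℚ] M) y₀)) := fun t =>
    (exists_map_some jM (hPM t)).1
  have hPt : ∀ t : Φ, Point.map (W' := curveA) jM (galPtOver M (t : M ≃ₐ[ℚ] M) zM) =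
      Point.some (jM ((t : M ≃ₐ[ℚ] M) x₀)) (jM ((t : M ≃ₐ[ℚ] M) y₀)) (hP t) := by
    intro t
    rw [GenusPeriodNorm.galPtOver_some (t : M ≃ₐ[ℚ] M) h₀, Point.map_some]
  -- halves in Ω
  have hhalf : ∀ t : Φ, ∃ (u w : Ω) (hq : (curveA.baseChange Ω).toAffine.Nonsingular u w), w ≠ 0 ∧
      (2 : ℕ) • (Point.some u w hq : APoint Ω) = Point.some (jM ((t : M ≃ₐ[ℚ] M) x₀)) (jM ((t : M ≃ₐ[ℚ] M) y₀)) (hP t) := by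
    intro t
    obtain ⟨Q, hQ⟩ := exists_two_smul_eq himΩ (Point.some (jM ((t : M ≃ₐ[ℚ] M) x₀)) (jM ((t : M ≃ₐ[ℚ] M) y₀)) (hP t))
    have hQ2 : (2 : ℕ) • Q ≠ 0 := by rw [hQ]; exact Point.some_ne_zero _
    obtain ⟨u, w, hq, hw, rfl⟩ := exists_eq_some_of_two_smul_ne_zero hQ2
    exact ⟨u, w, hq, hw, hQ⟩
  choose xQ yQ hQ hyQ hhalf using hhalf
  -- the sum: Σ_t P_t = j(Z(d)) = (jX, jY)
  have hsumM : ∑ t : Φ, Point.map (W' := curveA) jM (galPtOver M (t : M ≃ₐ[ℚ] M) zM) = Point.map (W' := curveA) j (D.Z d) := by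
    change _ = Point.map (W' := curveA) (jM.comp ι) (D.Z d)
    rw [← Point.map_map, hS1, map_sum]
    exact Finset.sum_coe_sort Φ (fun t => Point.map (W' := curveA) jM (galPtOver M t zM))
  obtain ⟨hS, hSe⟩ := exists_map_some j hXY
  have hsum : ∑ t : Φ, (Point.some (jM ((t : M ≃ₐ[ℚ] M) x₀)) (jM ((t : M ≃ₐ[ℚ] M) y₀)) (hP t) : APoint Ω) =
      Point.some (j X) (j Y) hS := by
    rw [← hSe, ← hZ, ← hsumM]
    exact Finset.sum_congr rfl fun t _ => (hPt t).symm
  -- the trace–norm theorem over Ω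
  obtain ⟨ρ, hρ, hfix⟩ := traceNorm_sq_fixed_zero himΩ (fun t : Φ => jM ((t : M ≃ₐ[ℚ] M) x₀)) (fun t => jM ((t : M ≃ₐ[ℚ] M) y₀)) hP
    xQ yQ hQ hyQ hhalf hS hsum
  -- ρ is fixed by every automorphism of Ω fixing j(ℍ′_n)
  have hfixed : ∀ σ : Ω ≃ₐ[ℚ] Ω, σ ∈ IntermediateField.fixingSubgroup j.fieldRange → σ ρ = ρ := by
    intro σ hσ
    rw [IntermediateField.mem_fixingSubgroup_iff] at hσ
    have hσj : ∀ a : D.H, σ (j a) = j a := fun a => hσ _ (AlgHom.mem_fieldRange.mpr ⟨a, rfl⟩)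
    refine hfix σ (hσj D.im) ?_
    -- the restriction of σ to M is trivial on ι(L_d(i)), so it permutes the z^t (S3)
    let g : M ≃ₐ[ℚ] M := σ.restrictNormal M
    have hg : ∀ m : M, jM (g m) = σ (jM m) := fun m => AlgEquiv.restrictNormal_commutes σ M m
    have hgι : ∀ a : D.H, g (ι a) = ι a := fun a =>
      (algebraMap M Ω).injective (by
        change jM (g (ι a)) = jM (ι a)
        rw [hg]; exact hσj a)
    have hgL : D.TrivialOnLOver ι d g := ⟨hgι _, fun d' _ _ => hgι _⟩
    obtain ⟨π, hπ, hperm⟩ := hS3 g hgL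
    refine ⟨Equiv.ofBijective π hπ, fun t => ?_⟩
    -- galPtOver Ω σ (P_t) = j(g · z^t) = P_{π t}
    have hcomp : (σ : Ω →ₐ[ℚ] Ω).comp jM = jM.comp (g : M →ₐ[ℚ] M) := AlgHom.ext fun m => (hg m).symm
    have e1 : galPtOver Ω σ (Point.map (W' := curveA) jM (galPtOver M (t : M ≃ₐ[ℚ] M) zM)) =
        Point.map (W' := curveA) jM (galPtOver M g (galPtOver M (t : M ≃ₐ[ℚ] M) zM)) := by
      rw [galPtOver, galPtOver, Point.map_map, Point.map_map]
      exact congrArg (fun f => Point.map (W' := curveA) f (galPtOver M (t : M ≃ₐ[ℚ] M) zM)) hcomp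
    rw [← hPt t, e1, hperm t, hPt]
    rfl
  -- hence ρ ∈ j(ℍ′_n)
  haveI : Algebra.IsAlgebraic ℚ Ω := Algebra.IsAlgebraic.trans ℚ M Ω
  haveI : IsAlgClosure ℚ Ω := { isAlgClosed := inferInstance, isAlgebraic := inferInstance }
  haveI : Algebra.IsSeparable ℚ Ω := Algebra.IsAlgebraic.isSeparable_of_perfectField
  haveI : Normal ℚ Ω := IsAlgClosure.normal ℚ Ω
  haveI : IsGalois ℚ Ω := IsGalois.mk
  have hρmem : ρ ∈ IntermediateField.fixedField (IntermediateField.fixingSubgroup j.fieldRange) := by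
    rw [IntermediateField.mem_fixedField_iff]; exact fun σ hσ => hfixed σ hσ
  rw [InfiniteGalois.fixedField_fixingSubgroup] at hρmem
  obtain ⟨r, hr⟩ := AlgHom.mem_fieldRange.mp hρmem
  -- pull the identity back to ℍ′_n
  have hprod : ∏ t : Φ, jM ((t : M ≃ₐ[ℚ] M) x₀) = j N₀ := by
    change _ = jM (ι N₀)
    rw [hN₀, map_prod, ← Finset.prod_coe_sort Φ]
  have hdesc : X * N₀ = r ^ 2 := by
    have hinj : Function.Injective j := j.toRingHom.injective
    apply hinj
    rw [map_mul, map_pow, hr, ← hρ, hprod]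
  exact ⟨hN0, GenusPeriodExactDescent.twoDescentComponent_eq_sqClass_of_exactDescent_zero D hXY hZ hX2 hN0 hdesc⟩

end Descent

/-! ## §7 By name: the exact-descent identities from the display fact, and C⁺ on the visible R2 rows as ONE square-class question -/

section ByName

variable {n : ℕ}

open Literature.NumberTheory.EllipticCurves.TianYuanZhang2017.GenusPointData (galPtOver)

/-- ★★★ **Both exact-descent identities from the seven-block display (S) at `d`**, for `Z(d)` not `2`-torsion: there are the display's `M ⊇ ℍ′_n`, `ι`, the CM
point `z = (x₀, y₀)`, `Φ` (`#Φ = g(d)`, `ι(Z(d)) = Σ_{t∈Φ} z^t`) and `N₁, N₀ ∈ ℍ′_n` with `ι(N₁) = ∏_{t∈Φ} t x₀ = N_{H/L}(x(z))`,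
`ι(N₀) = ∏_{t∈Φ} (t x₀ − 2ι(i)) = N_{H(i)/M}(x(z) − 2i)` and **`κ⁰_{ℍ′}(Z(d)) = [N₁]`, `κ⁺_{ℍ′}(Z(d)) = [N₀]`**.
[cite: TianYuanZhang2017, §3.1 (p0011 L53–L66), §3.2 (p0012 L8–L9)] [cite: SilvermanAEC2009, Thm. X.1.1, Prop. X.1.4] [cite: NeukirchSchmidtWingberg2008, §1.5] -/
theorem exists_norms_exactDescent (D : GenusPointData n) {d : ℕ} (hS : D.SevenBlockCMSpec d) (hZ2 : (2 : ℕ) • D.Z d ≠ 0) :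
    ∃ (M : Type) (_ : Field M) (_ : NumberField M) (_ : IsGalois ℚ M) (ι : D.H →ₐ[ℚ] M) (x₀ y₀ : M)
      (h₀ : (curveA.baseChange M).toAffine.Nonsingular x₀ y₀) (Φ : Finset (M ≃ₐ[ℚ] M)) (N₁ N₀ : D.H),
      Φ.card = gK d ∧
      Point.map (W' := curveA) ι (D.Z d) = ∑ t ∈ Φ, galPtOver M t (.some x₀ y₀ h₀) ∧
      ι N₁ = ∏ t ∈ Φ, (t : M ≃ₐ[ℚ] M) x₀ ∧
      ι N₀ = ∏ t ∈ Φ, ((t : M ≃ₐ[ℚ] M) x₀ - 2 * ι D.im) ∧ N₁ ≠ 0 ∧ N₀ ≠ 0 ∧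
      twoDescentComponent (curveA.baseChange D.H).toAffine 0 (2 * D.im) (-(2 * D.im)) (D.Z d) = sqClass N₁ ∧
      twoDescentComponent (curveA.baseChange D.H).toAffine (2 * D.im) 0 (-(2 * D.im)) (D.Z d) = sqClass N₀ := by
  obtain ⟨M, iF, iN, iG, ι, z, Φ, ⟨hS1, hcard⟩, hS2, hS3⟩ := hS
  have hΦ : Φ.Nonempty := Finset.card_pos.mp (by rw [hcard]; exact GenusPeriodNorm.gK_pos d)
  obtain ⟨t₀, ht₀⟩ := hΦ
  have hz : z ≠ 0 := by
    intro hz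
    apply GenusPointData.galPtOver_ne_zero_of_not_cusp hS2 ht₀
    rw [hz, _root_.map_zero]
  rcases z with _ | ⟨x₀, y₀, h₀⟩
  · exact absurd rfl hz
  obtain ⟨N₁, hN₁, hne₁, hκ₁⟩ := twoDescentComponent_genusPeriod_eq_sqClass_norm_zero D ι h₀ Φ hS1 hS2 hS3 hZ2
  obtain ⟨N₀, hN₀, hne₀, hκ₀⟩ := twoDescentComponent_genusPeriod_eq_sqClass_norm D ι h₀ Φ hS1 hS2 hS3 hZ2
  exact ⟨M, iF, iN, iG, ι, x₀, y₀, h₀, Φ, N₁, N₀, hcard, hS1, hN₁, hN₀, hne₁, hne₀, hκ₁, hκ₀⟩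

/-- ★★★★ **C⁺ ON A VISIBLE R2 ROW IS THE SQUARE CLASS OF ONE ELLIPTIC-UNIT NORM — granted only the first coordinate (THEOREM A).**  Granted conjuncts
1, 2, 4, 5 of 𝔅_ram and the display fact `tyz_sevenBlockCMData`; primes `l ≡ 1`, `q ≡ 7 (mod 8)`, `n = lq`, `ord_{s=1} L(E_n, s) = 1`; a VISIBLE generator
`h = (X, Y)` of `A_n(ℚ)` modulo torsion (`X ∉ 2ℚ^{×2}`).  Then there is a display package `D` of `n` (`Printed`, CM layer, Thm 3.5 at blocks) such that,
if `Z(n)` is not `2`-torsion, there are `M ⊇ ℍ′_n`, the CM point `z_n = (x₀, y₀)`, `Φ` (`#Φ = g(n)`) and the norms `N₁ = N_{H/L}(x(z_n))`,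
`N₀ = N_{H(i)/M}(x(z_n) − 2i)` in `ℍ′_n` (exact-descent identities PROVED, §6) with:  **`[N₁] = 1` (Theorem A) and `ζ₈ ∉ ℍ′_n` ⟹
( `2 ∥ L` for every `L` with `𝓛(n)² = L²`  ⟺  neither `N₀` nor `N₀·i` is a square in `ℍ′_n` ).**
[cite: TianYuanZhang2017, §1, §3.1, §3.2, Thm. 3.5, Lemma 3.18, Thm. 1.2] [cite: BurungaleFlach2024, Thm 1.1 / Cor. 3] [cite: Darmon2004, Thm. 3.22]
[cite: SilvermanAEC2009, Thm. X.1.1, Prop. X.1.4] [cite: NeukirchSchmidtWingberg2008, §1.5] -/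
theorem levelTwo_iff_secondNorm_of_visible_R2_of_facts (hGZK : rank_eq_analyticRank_of_analyticRank_le_one)
    (hmod : WeierstrassCurve.hasEntireLFunction_rat) (hCM0 : bsdTriple_of_hasCM_of_L_one_ne_zero) (h12 : thm12_parity_of_scriptL')
    (hT : tyz_sevenBlockCMData)
    {l q : ℕ} (hl : l.Prime) (hq : q.Prime) (hl8 : l % 8 = 1) (hq8 : q % 8 = 7) (hn : n = l * q)
    (hr : (congruentNumberCurve n).analyticRank = 1)
    {X Y : ℚ} (h : (Atwo n).toAffine.Nonsingular X Y) (hX : ¬ ∃ s : ℚ, X = 2 * s ^ 2)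
    (hgen : ∀ P : (Atwo n).toAffine.Point, ∃ m : ℤ, IsOfFinAddOrder (P - m • (Point.some X Y h : (Atwo n).toAffine.Point))) :
    ∃ D : GenusPointData n, D.Printed ∧ D.CMPointCompositumPrinted ∧ D.Thm35AtBlocks ∧
      ((2 : ℕ) • D.Z n ≠ 0 →
        ∃ (M : Type) (_ : Field M) (_ : NumberField M) (_ : IsGalois ℚ M) (ι : D.H →ₐ[ℚ] M) (x₀ y₀ : M)
          (h₀ : (curveA.baseChange M).toAffine.Nonsingular x₀ y₀) (Φ : Finset (M ≃ₐ[ℚ] M)) (N₁ N₀ : D.H),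
          Φ.card = gK n ∧
          Point.map (W' := curveA) ι (D.Z n) = ∑ t ∈ Φ, galPtOver M t (.some x₀ y₀ h₀) ∧
          ι N₁ = ∏ t ∈ Φ, (t : M ≃ₐ[ℚ] M) x₀ ∧
          ι N₀ = ∏ t ∈ Φ, ((t : M ≃ₐ[ℚ] M) x₀ - 2 * ι D.im) ∧ N₁ ≠ 0 ∧ N₀ ≠ 0 ∧
          (sqClass N₁ = 1 → sqClass D.im ≠ 1 →
            ((∀ L : ℤ, IsScriptL n L → (2 : ℤ) ∣ L ∧ ¬ (4 : ℤ) ∣ L) ↔ ¬ ((∃ s : D.H, N₀ = s ^ 2) ∨ ∃ s : D.H, N₀ * D.im = s ^ 2)))) := by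
  have hmod8 : n % 8 = 7 := by rw [hn, Nat.mul_mod, hl8, hq8]
  have hsq : Squarefree n := by
    subst hn
    have hne : l ≠ q := fun h => by subst h; omega
    exact Nat.squarefree_mul_iff.mpr ⟨(Nat.coprime_primes hl hq).mpr hne, hl.squarefree, hq.squarefree⟩
  obtain ⟨D, hPr, hC, hBl, hSeven⟩ := hT n hsq (Or.inr (Or.inr hmod8))
  refine ⟨D, hPr, hC, hBl, fun hZ2 => ?_⟩
  obtain ⟨M, iF, iN, iG, ι, x₀, y₀, h₀, Φ, N₁, N₀, hcard, hS1, hN₁, hN₀, hne₁, hne₀, hκ₁, hκ₀⟩ :=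
    exists_norms_exactDescent D (hSeven n (Nat.mem_divisors_self n hsq.ne_zero) hmod8) hZ2
  refine ⟨M, iF, iN, iG, ι, x₀, y₀, h₀, Φ, N₁, N₀, hcard, hS1, hN₁, hN₀, hne₁, hne₀, fun hA hi8 => ?_⟩
  exact GenusPeriodExactDescent.levelTwo_iff_secondNorm_of_visible_R2 hGZK hmod hCM0 h12 hl hq hl8 hq8 hn hr D hPr hC hBl hi8 h hX hgen hne₀
    hκ₁ hκ₀ hA

end ByName

end Summit.BirchSwinnertonDyer.PrintCf2.GenusPeriodTraceNorm

end
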